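import Summits.QuantumFields.BalabanUV.Beta.GAN24.ThreeKernelRowVBound
import Summits.QuantumFields.BalabanUV.Beta.GAN24.TaylorRowVSymAn1At

/-!
# Road S3, DIFF row R3-dV part (a) FOR an1's SYMMETRISED BORDER TABLE `borderSum (Lc^(m+1)) (symVhSAt (toSite r) d Lc)`: **the row-V count with three
# abstract kernel legs, `abs_entry3_le`, at every in-block root, SAME constants** (An1 twin of road-P2 g33's `ThreeKernelRowVBoundSymAt`; corner-root base
# `ThreeKernelRowVBound` BY NAME; the input of `S3DiffVSymAn1At`)

NOT IN PRINT — OUR BOOKKEEPING (road-P2 = `b2b-balaban-gan24-p2` gen 56, 2026-08-25; row G-an2-4 ∕ (CONV-C), the (α-0) chain at row D1's literal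
OF RECORD (III′) `JsB12CombShSym`; [folklore] composition BY NAME; 0 `def`, 0 cite, 0 `def … : Prop`, 0 `sorry`).  Weight 0.  NEVER «G-an2-4 closed» as (CONV-C);
NOT D1, NOT BetaPertH, NOT continuum, NOT Clay; NO campaign opened (an2 W-4) — typed while idle under R-2 as a brick of the located «SYM-S3-V-DIFF» transfer
(the RAW UNDRESSED top-aligned V PAIR letter of the (III′) V-born RATE half `hBd-V`, road-P2 MEMO M-gan24p2-g56-1, `gen56/S-CAMPAIGN-SIZING-g56.v0_7.md` §2(d)).

NAMING: in the existing (E) files «Sym» (`…SymAt`) = the UN-NEGATED rooted border `vhSAt ρ` (the OWNER's W15); «An1» (this file) = an1's (0.4)-SYMMETRISED border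
`SymAveragingHessianCounts.symVhSAt ρ` — the type of the record field `SymTables.V`.  METHOD = road-P2's `tools/mkstab.py` (the OWNER gan24-p1's gen-6 `mkroot.py`
rule): the (E) «Sym» file VERBATIM with `vhSAt (toSite r) d Lc ↦ symVhSAt (toSite r) d Lc` — the symmetrised border has the SAME support ∕ entry ∕ locality letters
(`symVhKerAt_eq_zero_left ∕ _right`, `abs_symVhKerAt_le ≤ 3ℓ²`, `locStencil_symVhSAt`) and the SAME `rfl`-zero ff ∕ mm blocks (accessors `TaylorMassVHAn1At.symVhSAt_inl_inl ∕
_inr_inr`, M.78); every table-free lemma of the base modules is used BY NAME (not re-declared); same theorem names in this file's namespace; base and «Sym» modules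
untouched; no zero-root sanity `example`.  Discharges NOTHING of (hS, hSall), the K-slot, hBdev or BetaPertH by itself.

## Contents (`d` generic; root `r ∈ box (d+1) Lc`)
**`abs_entry3_le`** — the three-leg row-V count (masses ∕ supports from M.84 `TaylorRowVSymAn1At`), the SAME displayed constant as the «Sym» file.
-/

noncomputable section

open Finset
open scoped BigOperators
open Literature.MathematicalPhysics.QuantumFieldTheory
open Literature.MathematicalPhysics.QuantumFieldTheory.Balaban1983to89
open Literature.MathematicalPhysics.QuantumFieldTheory.Balaban1983to89.Beta
open LatticeForm (quo)
open B12Sec2to5 (l1 l1_nonneg)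
open ExpKernelCalculus (MKer Zl Zl_pos l1_sub_symm)
open OneStepResolventKernel (Fib LocStencil KInv)
open AveragingHessianKernels (ell)
open BalabanCompositeJets (pushSum)
open DecLiftAdjoint (borderSum)
open AffineAveraging (box toSite)
open Summit.QuantumFields.BalabanUV.Beta.SymAveragingHessianCounts (symVhSAt symVhKerAt symVhKerAt_eq_zero_left symVhKerAt_eq_zero_right abs_symVhKerAt_le
  locStencil_symVhSAt symVhSAt_symm)
open Summit.QuantumFields.BalabanUV.Beta.GAN24.E3UnitSplitLevelsVSymAn1At (pushSum_borderSumV_inl_inl pushSum_borderSumV_inr_inr)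
open Summit.QuantumFields.BalabanUV.Beta.GAN24.ThirdJetThreeKernel (e3K3 e3K3_inr_left e3K3_inr_right e3K3_VH_unit_split_of)
open Summit.QuantumFields.BalabanUV.Beta.GAN24.TaylorMassVHSymAn1At (sum_abs_pushSum_borderSumV_inl_inr_le
  sum_abs_pushSum_borderSumV_inr_inl_le pushSum_borderSumV_inl_inr_ne_zero)
open Summit.QuantumFields.BalabanUV.Beta.GAN24.TaylorRowVSupportSymAn1At (pushSum_borderSumV_inr_inl_ne_zero)
open Summit.QuantumFields.BalabanUV.Beta.GAN24.OffDiagSandwich (const_nonneg_of_dom)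
open Summit.QuantumFields.BalabanUV.Beta.GAN24.OffDiagSandwichSum (sum_abs_channel_le_col sum_abs_channel_le_row)
open Summit.QuantumFields.BalabanUV.Beta.GAN24.TaylorRowVSupport

namespace Summit.QuantumFields.BalabanUV.Beta.GAN24.ThreeKernelRowVBoundSymAn1At

variable {d : ℕ} {Lc : ℕ} [NeZero Lc]

variable {κ CXΦ CXG CY CZH CZΦ : ℝ}

/-- **THE ENTRY ESTIMATE OF ROW V WITH THREE ABSTRACT KERNEL LEGS, AT THE IN-BLOCK ROOT** [folklore] (generic `d`, `Lc ≥ 1`; member `p = m+k+3`, `N = Lc^p`, the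
ROOTED SYMMETRIC border table `borderSum (Lc^{m+1}) (symVhSAt (toSite r) d Lc)` of level `m+1` pushed `k+1` times; SAME constants as the base, root-free).  Hypotheses: the five relevant leg blocks of the row kernel `X` (`mm`, `mf`), the vertex
kernel `Y` (`fm` = its `ℋ`-column) and the column kernel `Z` (`fm`, `mm`) at THIS member, unit-normalised (`N^{2(d+1)}` on `mm`, `N^{d+2}` on
mixed blocks), each decaying on the block scale at one common rate `κ > 0`.  Conclusion: see the module docstring.  The unit split is part 2's
`e3K3_VH_unit_split_of`; the two channels by `OffDiagSandwichSum.sum_abs_channel_le_row` / `_col` with VH1's ROW-form masses and the supports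
keyed to the vertex location; the prefactor by `TaylorRowVSupport.prefactor_eq`.  NO cancellation is used (the smallness of a DIFFERENCE leg
enters only through its constant). -/
theorem abs_entry3_le (hL : 1 ≤ Lc) (hκ : 0 < κ) (X Y Z : MKer (d + 1) (Fib d)) (m k p : ℕ) (hp : p = m + k + 1 + 1 + 1)
    (hXΦ : ∀ (x' w : Fin (d + 1) → ℤ) (α β : Fin (d + 1)),
      |((Lc : ℝ) ^ p) ^ (2 * (d + 1)) * X (((Lc ^ p : ℕ) : ℤ) • x') w (Sum.inr α) (Sum.inr β)| ≤
        CXΦ * Real.exp (-κ * l1 (x' - quo (Lc ^ p) w)))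
    (hXG : ∀ (x' w : Fin (d + 1) → ℤ) (α l : Fin (d + 1)),
      |((Lc : ℝ) ^ p) ^ (d + 2) * X (((Lc ^ p : ℕ) : ℤ) • x') w (Sum.inr α) (Sum.inl l)| ≤
        CXG * Real.exp (-κ * l1 (x' - quo (Lc ^ p) w)))
    (hY : ∀ (k l : Fin (d + 1)) (u u' : Fin (d + 1) → ℤ),
      |((Lc : ℝ) ^ p) ^ (d + 2) * Y u (((Lc ^ p : ℕ) : ℤ) • u') (Sum.inl k) (Sum.inr l)| ≤
        CY * Real.exp (-κ * l1 (quo (Lc ^ p) u - u')))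
    (hZH : ∀ (l β : Fin (d + 1)) (y z' : Fin (d + 1) → ℤ),
      |((Lc : ℝ) ^ p) ^ (d + 2) * Z y (((Lc ^ p : ℕ) : ℤ) • z') (Sum.inl l) (Sum.inr β)| ≤
        CZH * Real.exp (-κ * l1 (quo (Lc ^ p) y - z')))
    (hZΦ : ∀ (l β : Fin (d + 1)) (y z' : Fin (d + 1) → ℤ),
      |((Lc : ℝ) ^ p) ^ (2 * (d + 1)) * Z y (((Lc ^ p : ℕ) : ℤ) • z') (Sum.inr l) (Sum.inr β)| ≤
        CZΦ * Real.exp (-κ * l1 (quo (Lc ^ p) y - z')))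
    {r : Fin (d + 1) → ℕ} (hr : r ∈ box (d + 1) Lc) (cVH : ℝ) (κ' : Fin (d + 1)) (u' x' z' : Fin (d + 1) → ℤ) (α β : Fin (d + 1)) :
    |((Lc : ℝ) ^ p) ^ (2 * (d + 1)) *
        e3K3 X Y Z (Lc ^ p)
          (fun κ u => (((Lc : ℝ) ^ (d + 1)) ^ (k + 1) * (cVH * ((Lc : ℝ) ^ (m + 1)) ^ (d + 2))) •
            pushSum (Lc ^ (m + 1 + 1)) (Lc ^ (k + 1)) (borderSum (Lc ^ (m + 1)) (fun κ₀ z₀ => symVhSAt (toSite r) d Lc rfl κ₀ z₀) κ u)) κ' u' x' z' (Sum.inl α) (Sum.inl β)| ≤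
      (|cVH| * ((d : ℝ) + 1) ^ 3 * (CZH * CY * CXΦ + CXG * CY * CZΦ) *
          (((((2 * (2 * (d + 1) * (Lc + 1) + (2 * d + 3)) + 1) ^ (d + 1) : ℕ) : ℝ)) ^ 2 * (3 * (ell (d + 1) Lc : ℝ) ^ 2)) *
          Real.exp (κ * (2 * ((2 * (d + 1) * (Lc + 1) + (2 * d + 3) : ℕ) : ℝ) + 4 * ((d : ℝ) + 1))) *
          Zl (d + 1) (κ / 2) * (((Lc : ℝ) ^ (d + 1))⁻¹ * ((Lc : ℝ) ^ 2)⁻¹)) *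
        ((Lc : ℝ)⁻¹) ^ (k + 1) * Real.exp (-(κ / 2) * (l1 (x' - u') + l1 (z' - u'))) := by
  -- (0) constants and abbreviations
  have hLpos : (0 : ℝ) < Lc := by exact_mod_cast Nat.lt_of_lt_of_le Nat.zero_lt_one hL
  have hCXΦ : 0 ≤ CXΦ := const_nonneg_of_dom (hXΦ 0 0 0 0)
  have hCXG : 0 ≤ CXG := const_nonneg_of_dom (hXG 0 0 0 0)
  have hCY : 0 ≤ CY := const_nonneg_of_dom (hY 0 0 0 0)
  have hCZH : 0 ≤ CZH := const_nonneg_of_dom (hZH 0 0 0 0)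
  have hCZΦ : 0 ≤ CZΦ := const_nonneg_of_dom (hZΦ 0 0 0 0)
  set R : ℕ := 2 * (d + 1) * (Lc + 1) + (2 * d + 3) with hR
  set r₁ : ℕ := R * Lc ^ (m + 1) with hr₁
  set r₂ : ℕ := R * Lc ^ (m + 1) + 2 * (d + 1) * Lc ^ (k + 1) * (Lc ^ (m + 1) * Lc) with hr₂
  set mT : ℝ := ((Lc ^ (k + 1) : ℕ) : ℝ) * ((((2 * R + 1) ^ (d + 1) : ℕ) : ℝ) *
    ((((Lc ^ (m + 1) : ℕ) : ℝ)) * (3 * (ell (d + 1) Lc : ℝ) ^ 2 / (((Lc ^ (m + 1) : ℕ) : ℝ)) ^ (d + 1)))) with hmT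
  -- (1) the unit split
  rw [e3K3_VH_unit_split_of (Lc := Lc) X Y Z _ (fun κ u x z α' β' => pushSum_borderSumV_inl_inl (toSite r) κ u x z α' β')
    (fun κ u x z μ ν => pushSum_borderSumV_inr_inr (toSite r) κ u x z μ ν) cVH (m + 1) (k + 1) p (by rw [hp]; ring) κ' u' x' z' α β, abs_mul]
  -- (2) the legs of this member
  have hc : ((((Lc : ℝ) ^ p) ^ (d + 1))⁻¹) = ((((Lc ^ p : ℕ) : ℝ)) ^ (d + 1))⁻¹ := by push_cast; rfl
  have hmass₂ : ∀ (kk : Fin (d + 1)) (u w : Fin (d + 1) → ℤ) (l l' : Fin (d + 1)) (Yf : Finset (Fin (d + 1) → ℤ)),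
      ∑ y ∈ Yf, |pushSum (Lc ^ (m + 1 + 1)) (Lc ^ (k + 1)) (borderSum (Lc ^ (m + 1)) (fun κ₀ z₀ => symVhSAt (toSite r) d Lc rfl κ₀ z₀) kk u) w y (Sum.inl l) (Sum.inr l')| ≤ mT := by
    intro kk u w l l' Yf
    have h := sum_abs_pushSum_borderSumV_inl_inr_le (Lc ^ (m + 1)) (Lc ^ (k + 1)) hL hr kk u w l l' Yf
    rw [← pow_succ] at h
    exact h
  have hmass₁ : ∀ (kk : Fin (d + 1)) (u y : Fin (d + 1) → ℤ) (l l' : Fin (d + 1)) (W : Finset (Fin (d + 1) → ℤ)),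
      ∑ w ∈ W, |pushSum (Lc ^ (m + 1 + 1)) (Lc ^ (k + 1)) (borderSum (Lc ^ (m + 1)) (fun κ₀ z₀ => symVhSAt (toSite r) d Lc rfl κ₀ z₀) kk u) w y (Sum.inr l) (Sum.inl l')| ≤ mT := by
    intro kk u y l l' W
    have h := sum_abs_pushSum_borderSumV_inr_inl_le (Lc ^ (m + 1)) (Lc ^ (k + 1)) hL hr kk u y l l' W
    rw [← pow_succ] at h
    exact h
  have hr₂cast : (((R * Lc ^ (m + 1) : ℕ) : ℝ)) + 2 * ((d : ℝ) + 1) * ((Lc ^ (k + 1) : ℕ) : ℝ) * ((Lc ^ (m + 1) * Lc : ℕ) : ℝ) =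
      ((r₂ : ℕ) : ℝ) := by
    rw [hr₂]; push_cast; ring
  have hsupp₂ : ∀ (kk : Fin (d + 1)) (u w y : Fin (d + 1) → ℤ) (l l' : Fin (d + 1)),
      pushSum (Lc ^ (m + 1 + 1)) (Lc ^ (k + 1)) (borderSum (Lc ^ (m + 1)) (fun κ₀ z₀ => symVhSAt (toSite r) d Lc rfl κ₀ z₀) kk u) w y (Sum.inl l) (Sum.inr l') ≠ 0 →
        l1 (w - u) ≤ r₁ ∧ l1 (y - u) ≤ r₂ := by
    intro kk u w y l l' hne
    have h := pushSum_borderSumV_inl_inr_ne_zero (Lc ^ (m + 1)) (Lc ^ (k + 1)) hL hr (by rw [← pow_succ]; exact hne)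
    refine ⟨h.2.1, ?_⟩
    rw [← hr₂cast]; exact h.2.2
  have hsupp₁ : ∀ (kk : Fin (d + 1)) (u w y : Fin (d + 1) → ℤ) (l l' : Fin (d + 1)),
      pushSum (Lc ^ (m + 1 + 1)) (Lc ^ (k + 1)) (borderSum (Lc ^ (m + 1)) (fun κ₀ z₀ => symVhSAt (toSite r) d Lc rfl κ₀ z₀) kk u) w y (Sum.inr l) (Sum.inl l') ≠ 0 →
        l1 (w - u) ≤ r₂ ∧ l1 (y - u) ≤ r₁ := by
    intro kk u w y l l' hne
    have h := pushSum_borderSumV_inr_inl_ne_zero (Lc ^ (m + 1)) (Lc ^ (k + 1)) hL hr (by rw [← pow_succ]; exact hne)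
    refine ⟨?_, h.2⟩
    rw [← hr₂cast]; exact h.1
  -- (3) the two channels, partial sums
  set E : ℝ := Real.exp (-(κ / 2) * (l1 (x' - u') + l1 (z' - u'))) with hE
  set Bnd₁ : ℝ := (Fintype.card (Fin (d + 1)) : ℝ) ^ 3 * (CZH * CY * CXΦ * mT) * (2 * r₁ + 1 : ℝ) ^ (d + 1) *
    Real.exp (κ * (((r₁ : ℝ) + r₂) / ((Lc ^ p : ℕ) : ℝ) + 2 * ((d + 1 : ℕ) : ℝ))) * (Zl (d + 1) (κ / 2) * E) with hBnd₁
  set Bnd₂ : ℝ := (Fintype.card (Fin (d + 1)) : ℝ) ^ 3 * (CXG * CY * CZΦ * mT) * (2 * r₁ + 1 : ℝ) ^ (d + 1) *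
    Real.exp (κ * (((r₁ : ℝ) + r₂) / ((Lc ^ p : ℕ) : ℝ) + 2 * ((d + 1 : ℕ) : ℝ))) * (Zl (d + 1) (κ / 2) * E) with hBnd₂
  have h1 : ∀ Yf : Finset (Fin (d + 1) → ℤ), ∑ y ∈ Yf, |∑ l' : Fin (d + 1),
      (∑' w : Fin (d + 1) → ℤ, ∑ l : Fin (d + 1),
          (((Lc : ℝ) ^ p) ^ (2 * (d + 1)) * X (((Lc ^ p : ℕ) : ℤ) • x') w (Sum.inr α) (Sum.inr l)) *
          ∑ κ'' : Fin (d + 1), (((Lc : ℝ) ^ p) ^ (d + 1))⁻¹ * ∑' u : Fin (d + 1) → ℤ,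
            (((Lc : ℝ) ^ p) ^ (d + 2) * Y u (((Lc ^ p : ℕ) : ℤ) • u') (Sum.inl κ'') (Sum.inr κ')) *
              pushSum (Lc ^ (m + 1 + 1)) (Lc ^ (k + 1)) (borderSum (Lc ^ (m + 1)) (fun κ₀ z₀ => symVhSAt (toSite r) d Lc rfl κ₀ z₀) κ'' u) w y (Sum.inr l) (Sum.inl l')) *
        (((Lc : ℝ) ^ p) ^ (d + 2) * Z y (((Lc ^ p : ℕ) : ℤ) • z') (Sum.inl l') (Sum.inr β))| ≤ Bnd₁ := by
    intro Yf
    have h := sum_abs_channel_le_row (ι := Fin (d + 1)) (D := d + 1) (Lc ^ p)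
      (fun l w => ((Lc : ℝ) ^ p) ^ (2 * (d + 1)) * X (((Lc ^ p : ℕ) : ℤ) • x') w (Sum.inr α) (Sum.inr l))
      (fun κ'' u => ((Lc : ℝ) ^ p) ^ (d + 2) * Y u (((Lc ^ p : ℕ) : ℤ) • u') (Sum.inl κ'') (Sum.inr κ'))
      (fun l' y => ((Lc : ℝ) ^ p) ^ (d + 2) * Z y (((Lc ^ p : ℕ) : ℤ) • z') (Sum.inl l') (Sum.inr β))
      (fun κ'' u w y l l' => pushSum (Lc ^ (m + 1 + 1)) (Lc ^ (k + 1)) (borderSum (Lc ^ (m + 1)) (fun κ₀ z₀ => symVhSAt (toSite r) d Lc rfl κ₀ z₀) κ'' u) w y (Sum.inr l) (Sum.inl l'))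
      ((((Lc : ℝ) ^ p) ^ (d + 1))⁻¹) hc x' u' z' hκ
      (fun l w => by rw [l1_sub_symm]; exact hXΦ x' w α l)
      (fun κ'' u => hY κ'' κ' u u')
      (fun l' y => hZH l' β y z')
      hmass₁ hsupp₁ Yf
    refine h.trans (le_of_eq ?_)
    rw [hBnd₁, add_comm (l1 (z' - u')) (l1 (x' - u'))]
  have h2 : ∀ Yf : Finset (Fin (d + 1) → ℤ), ∑ y ∈ Yf, |∑ l' : Fin (d + 1),
      (∑' w : Fin (d + 1) → ℤ, ∑ l : Fin (d + 1),
          (((Lc : ℝ) ^ p) ^ (d + 2) * X (((Lc ^ p : ℕ) : ℤ) • x') w (Sum.inr α) (Sum.inl l)) *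
          ∑ κ'' : Fin (d + 1), (((Lc : ℝ) ^ p) ^ (d + 1))⁻¹ * ∑' u : Fin (d + 1) → ℤ,
            (((Lc : ℝ) ^ p) ^ (d + 2) * Y u (((Lc ^ p : ℕ) : ℤ) • u') (Sum.inl κ'') (Sum.inr κ')) *
              pushSum (Lc ^ (m + 1 + 1)) (Lc ^ (k + 1)) (borderSum (Lc ^ (m + 1)) (fun κ₀ z₀ => symVhSAt (toSite r) d Lc rfl κ₀ z₀) κ'' u) w y (Sum.inl l) (Sum.inr l')) *
        (((Lc : ℝ) ^ p) ^ (2 * (d + 1)) *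
          Z y (((Lc ^ p : ℕ) : ℤ) • z') (Sum.inr l') (Sum.inr β))| ≤ Bnd₂ := by
    intro Yf
    have h := sum_abs_channel_le_col (ι := Fin (d + 1)) (D := d + 1) (Lc ^ p)
      (fun l w => ((Lc : ℝ) ^ p) ^ (d + 2) * X (((Lc ^ p : ℕ) : ℤ) • x') w (Sum.inr α) (Sum.inl l))
      (fun κ'' u => ((Lc : ℝ) ^ p) ^ (d + 2) * Y u (((Lc ^ p : ℕ) : ℤ) • u') (Sum.inl κ'') (Sum.inr κ'))
      (fun l' y => ((Lc : ℝ) ^ p) ^ (2 * (d + 1)) * Z y (((Lc ^ p : ℕ) : ℤ) • z') (Sum.inr l') (Sum.inr β))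
      (fun κ'' u w y l l' => pushSum (Lc ^ (m + 1 + 1)) (Lc ^ (k + 1)) (borderSum (Lc ^ (m + 1)) (fun κ₀ z₀ => symVhSAt (toSite r) d Lc rfl κ₀ z₀) κ'' u) w y (Sum.inl l) (Sum.inr l'))
      ((((Lc : ℝ) ^ p) ^ (d + 1))⁻¹) hc x' u' z' hκ
      (fun l w => by rw [l1_sub_symm]; exact hXG x' w α l)
      (fun κ'' u => hY κ'' κ' u u')
      (fun l' y => hZΦ l' β y z')
      hmass₂ hsupp₂ Yf
    refine h.trans (le_of_eq ?_)
    rw [hBnd₂]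
  have hS := abs_tsum_add_le_of_sum_abs_le h1 h2
  -- (4) the constants `Bnd₁ + Bnd₂` against the explicit `L·M`-form
  have hcard : (Fintype.card (Fin (d + 1)) : ℝ) = (d : ℝ) + 1 := by simp
  have hexp : Real.exp (κ * (((r₁ : ℝ) + r₂) / ((Lc ^ p : ℕ) : ℝ) + 2 * ((d + 1 : ℕ) : ℝ))) ≤
      Real.exp (κ * (2 * (R : ℝ) + 4 * ((d : ℝ) + 1))) := by
    refine Real.exp_le_exp.2 (mul_le_mul_of_nonneg_left ?_ hκ.le)
    have hrad := radii_div_le (d := d) hL R m k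
    rw [← hr₁, ← hr₂, ← hp] at hrad
    push_cast at hrad ⊢
    linarith
  have hcm : (2 * (r₁ : ℝ) + 1) ^ (d + 1) * mT ≤
      ((((2 * R + 1) ^ (d + 1) : ℕ) : ℝ)) ^ 2 * (3 * (ell (d + 1) Lc : ℝ) ^ 2) * (Lc : ℝ) ^ (k + 1) * (Lc : ℝ) ^ (m + 1) := by
    have h := count_mul_mass_le (d := d) hL R (ell (d + 1) Lc : ℝ) m k
    rw [hr₁, hmT]
    exact h
  have hE0 : 0 ≤ E := (Real.exp_pos _).le
  have hZ : 0 ≤ Zl (d + 1) (κ / 2) := (Zl_pos (half_pos hκ)).le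
  have hC3 : 0 ≤ CZH * CY * CXΦ + CXG * CY * CZΦ := by positivity
  have hBnd_le : Bnd₁ + Bnd₂ ≤ ((d : ℝ) + 1) ^ 3 * (CZH * CY * CXΦ + CXG * CY * CZΦ) *
      (((((2 * R + 1) ^ (d + 1) : ℕ) : ℝ)) ^ 2 * (3 * (ell (d + 1) Lc : ℝ) ^ 2) * (Lc : ℝ) ^ (k + 1) * (Lc : ℝ) ^ (m + 1)) *
      Real.exp (κ * (2 * (R : ℝ) + 4 * ((d : ℝ) + 1))) * (Zl (d + 1) (κ / 2) * E) := by
    rw [hBnd₁, hBnd₂, hcard]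
    have e1 : ((d : ℝ) + 1) ^ 3 * (CZH * CY * CXΦ * mT) * (2 * (r₁ : ℝ) + 1) ^ (d + 1) *
          Real.exp (κ * (((r₁ : ℝ) + r₂) / ((Lc ^ p : ℕ) : ℝ) + 2 * ((d + 1 : ℕ) : ℝ))) * (Zl (d + 1) (κ / 2) * E) +
        ((d : ℝ) + 1) ^ 3 * (CXG * CY * CZΦ * mT) * (2 * (r₁ : ℝ) + 1) ^ (d + 1) *
          Real.exp (κ * (((r₁ : ℝ) + r₂) / ((Lc ^ p : ℕ) : ℝ) + 2 * ((d + 1 : ℕ) : ℝ))) * (Zl (d + 1) (κ / 2) * E) =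
        ((d : ℝ) + 1) ^ 3 * (CZH * CY * CXΦ + CXG * CY * CZΦ) * ((2 * (r₁ : ℝ) + 1) ^ (d + 1) * mT) *
          Real.exp (κ * (((r₁ : ℝ) + r₂) / ((Lc ^ p : ℕ) : ℝ) + 2 * ((d + 1 : ℕ) : ℝ))) * (Zl (d + 1) (κ / 2) * E) := by ring
    rw [e1]
    have hA0 : 0 ≤ ((d : ℝ) + 1) ^ 3 * (CZH * CY * CXΦ + CXG * CY * CZΦ) := by positivity
    exact mul_le_mul (mul_le_mul (mul_le_mul_of_nonneg_left hcm hA0) hexp (Real.exp_pos _).le (by positivity)) le_rfl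
      (by positivity) (by positivity)
  -- (5) assemble
  have hPF : |-(cVH / (Lc : ℝ) ^ (d + 1)) * ((Lc : ℝ) ^ p) ^ (-(2 : ℤ)) * (Lc : ℝ) ^ (m + 1)| =
      |cVH| * ((Lc : ℝ) ^ (d + 1))⁻¹ * (((Lc : ℝ) ^ p) ^ (-(2 : ℤ)) * (Lc : ℝ) ^ (m + 1)) := by
    rw [abs_mul, abs_mul, abs_neg, abs_div, abs_of_pos (pow_pos hLpos _), abs_of_pos (zpow_pos (pow_pos hLpos _) _),
      abs_of_pos (pow_pos hLpos _)]
    ring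
  have hpre := prefactor_eq (Lc := Lc) hL m k
  rw [← hp] at hpre
  calc |-(cVH / (Lc : ℝ) ^ (d + 1)) * ((Lc : ℝ) ^ p) ^ (-(2 : ℤ)) * (Lc : ℝ) ^ (m + 1)| * _
      ≤ |-(cVH / (Lc : ℝ) ^ (d + 1)) * ((Lc : ℝ) ^ p) ^ (-(2 : ℤ)) * (Lc : ℝ) ^ (m + 1)| * (Bnd₁ + Bnd₂) :=
        mul_le_mul_of_nonneg_left hS (abs_nonneg _)
    _ ≤ |cVH| * ((Lc : ℝ) ^ (d + 1))⁻¹ * (((Lc : ℝ) ^ p) ^ (-(2 : ℤ)) * (Lc : ℝ) ^ (m + 1)) *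
        (((d : ℝ) + 1) ^ 3 * (CZH * CY * CXΦ + CXG * CY * CZΦ) *
          (((((2 * R + 1) ^ (d + 1) : ℕ) : ℝ)) ^ 2 * (3 * (ell (d + 1) Lc : ℝ) ^ 2) * (Lc : ℝ) ^ (k + 1) * (Lc : ℝ) ^ (m + 1)) *
          Real.exp (κ * (2 * (R : ℝ) + 4 * ((d : ℝ) + 1))) * (Zl (d + 1) (κ / 2) * E)) := by
        rw [hPF]
        exact mul_le_mul_of_nonneg_left hBnd_le (by positivity)
    _ = (|cVH| * ((d : ℝ) + 1) ^ 3 * (CZH * CY * CXΦ + CXG * CY * CZΦ) *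
          (((((2 * R + 1) ^ (d + 1) : ℕ) : ℝ)) ^ 2 * (3 * (ell (d + 1) Lc : ℝ) ^ 2)) *
          Real.exp (κ * (2 * (R : ℝ) + 4 * ((d : ℝ) + 1))) *
          Zl (d + 1) (κ / 2) * (((Lc : ℝ) ^ (d + 1))⁻¹ * ((Lc : ℝ) ^ 2)⁻¹)) *
        ((Lc : ℝ)⁻¹) ^ (k + 1) * E := by
        have e2 : ((Lc : ℝ) ^ p) ^ (-(2 : ℤ)) * (Lc : ℝ) ^ (m + 1) * ((Lc : ℝ) ^ (k + 1) * (Lc : ℝ) ^ (m + 1)) =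
            ((Lc : ℝ) ^ 2)⁻¹ * ((Lc : ℝ)⁻¹) ^ (k + 1) := hpre
        calc |cVH| * ((Lc : ℝ) ^ (d + 1))⁻¹ * (((Lc : ℝ) ^ p) ^ (-(2 : ℤ)) * (Lc : ℝ) ^ (m + 1)) *
              (((d : ℝ) + 1) ^ 3 * (CZH * CY * CXΦ + CXG * CY * CZΦ) *
                (((((2 * R + 1) ^ (d + 1) : ℕ) : ℝ)) ^ 2 * (3 * (ell (d + 1) Lc : ℝ) ^ 2) * (Lc : ℝ) ^ (k + 1) * (Lc : ℝ) ^ (m + 1)) *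
                Real.exp (κ * (2 * (R : ℝ) + 4 * ((d : ℝ) + 1))) * (Zl (d + 1) (κ / 2) * E))
            = |cVH| * ((Lc : ℝ) ^ (d + 1))⁻¹ *
              (((Lc : ℝ) ^ p) ^ (-(2 : ℤ)) * (Lc : ℝ) ^ (m + 1) * ((Lc : ℝ) ^ (k + 1) * (Lc : ℝ) ^ (m + 1))) *
              (((d : ℝ) + 1) ^ 3 * (CZH * CY * CXΦ + CXG * CY * CZΦ) *
                (((((2 * R + 1) ^ (d + 1) : ℕ) : ℝ)) ^ 2 * (3 * (ell (d + 1) Lc : ℝ) ^ 2)) *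
                Real.exp (κ * (2 * (R : ℝ) + 4 * ((d : ℝ) + 1))) * (Zl (d + 1) (κ / 2) * E)) := by ring
          _ = _ := by rw [e2]; ring

end Summit.QuantumFields.BalabanUV.Beta.GAN24.ThreeKernelRowVBoundSymAn1At

end
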